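import Summits.KontsevichZagierPeriods.Zeta5Search.TwoTaleP15LineBoundNorm
import Summits.KontsevichZagierPeriods.Zeta5Search.TwoTaleLineBoundScaling
import Summits.KontsevichZagierPeriods.Zeta5Search.TwoTaleLineBoundLipschitz
import Summits.KontsevichZagierPeriods.Zeta5Search.TwoTaleLineBoundStirling

/-!
# The two-tale point P15: the scaled line bound `log ‖R_n‖ ≤ n·G(η) + O(log n + log(484+η²))` on `x = ⌊26n/5⌋ + ½`

HONEST FRAMING: systematic search; no irrationality claim unless certified.

Cell pub-zeta5, T3 service (P1 g9) — E5 of `families/denom/P15KERNEL.md` §6 up to (not including) the one-variable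
certificate and the `dy`-assembly.  On fam-denom's line `Re t = xₙ + ½`, `xₙ = ⌊26n/5⌋` (so `u = xₙ + ½ − (11n+1)`),
writing `y = nη` (`η ≠ 0`):

* `rateG η` — the explicit rate function
  `Σ± prim η Vᵢ* + 16 + (11 log 11 − 13 log 13 − 9 log 9 − 5 log 5)`, `V* = (36/5, −29/5 | 26/5, −19/5 | 16/5, −9/5 ‖ 101/5, 46/5)`,
  `prim η V = V·½log(V²+η²) − V + η·arctan(V/η)` (= fam-denom's `h(26/5, η) + 2π|η|` up to their normalisation of the
  constant row);
* **`log_norm_ratRC_line_le`**: for `n ≥ 1`, `η ≠ 0`,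
  `log ‖ratRC n (u + i·nη)‖ ≤ n·rateG η + 2·log n + 9·log(484 + η²) + K₀`, `K₀ = 12|log(3/10)| + 3(1+log 2) + 1`.
Ingredients: `log_norm_ratRC_le` (blocks), `prim_scale`/`halfLog_scale` (the `n log n` terms total `(16n−4) log n` and cancel
against Stirling's `−16 n log n`), `abs_prim_sub_prim_le` (the `O(1)` endpoint offsets, `|E − nV*| ≤ 3/2`, segment inside
`3/10 ≤ |W| ≤ 22`), `log_factorial_two_sided`.  What remains for `Decay c`: the certificate `∀ η, rateG η − 2π|η| ≤ −c − ε`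
(numerically `max = −29.1079` at `η = 2.15`) and `∫ dy` with `cosh²(πy) ≥ e^{2π|y|}/4`.
-/

noncomputable section

open Real Complex

namespace Summit.KontsevichZagierPeriods.Zeta5Search.TwoTaleLineBound

open Denom.TwoTaleP15Decay (ratRC)

/-- fam-denom's abscissa `xₙ = ⌊26n/5⌋`. -/
def xLine (n : ℕ) : ℕ := 26 * n / 5

/-- `u = xₙ + ½ − (11n+1)`, the real part of the argument of `R_n(t − a₂*)` on the line. -/
def uLine (n : ℕ) : ℝ := (xLine n : ℝ) + 1 / 2 - (11 * n + 1)

/-- The entropy row `11 log 11 − 13 log 13 − 9 log 9 − 5 log 5` of the factorial normalisation. -/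
def kappaP15 : ℝ := 11 * Real.log 11 - 13 * Real.log 13 - 9 * Real.log 9 - 5 * Real.log 5

/-- **The rate function** `G(η) = Σ± prim η Vᵢ* + 16 + κ`. -/
def rateG (η : ℝ) : ℝ :=
  (prim η (36 / 5) - prim η (-29 / 5)) + (prim η (26 / 5) - prim η (-19 / 5)) + (prim η (16 / 5) - prim η (-9 / 5))
    - (prim η (101 / 5) - prim η (46 / 5)) + 16 + kappaP15

/-- The Lipschitz constant of `prim η ·` on `3/10 ≤ |W| ≤ 22`. -/
def lipK (η : ℝ) : ℝ := |Real.log (3 / 10)| + Real.log (22 ^ 2 + η ^ 2) / 2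

/-- Floor bookkeeping: `−3/2 ≤ uₙ + 29n/5 ≤ −1/2`. -/
theorem uLine_bounds (n : ℕ) : -3 / 2 ≤ uLine n + 29 * n / 5 ∧ uLine n + 29 * n / 5 ≤ -1 / 2 := by
  unfold uLine xLine
  have h1 : 5 * (26 * n / 5) ≤ 26 * n := Nat.mul_div_le _ _
  have h2 : 26 * n < 5 * (26 * n / 5) + 5 := by omega
  have h1' : (5 : ℝ) * ((26 * n / 5 : ℕ) : ℝ) ≤ 26 * n := by exact_mod_cast h1
  have h2' : (26 : ℝ) * n < 5 * ((26 * n / 5 : ℕ) : ℝ) + 5 := by exact_mod_cast h2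
  constructor <;> linarith

variable {η : ℝ}

/-- `lipK η ≥ 0`. -/
theorem lipK_nonneg (η : ℝ) : 0 ≤ lipK η := by
  unfold lipK
  have : 0 ≤ Real.log (22 ^ 2 + η ^ 2) := Real.log_nonneg (by nlinarith [sq_nonneg η])
  positivity

/-- **Endpoint transfer**: an endpoint `E` with `|E − nV*| ≤ 3/2`, `9/5 ≤ |V*| ≤ 101/5`, satisfies
`|prim (nη) E − (n·prim η V* + E·log n)| ≤ (3/2)·lipK η` (`n ≥ 1`, `η ≠ 0`). -/
theorem prim_endpoint (hη : η ≠ 0) {n : ℕ} (hn : 1 ≤ n) {E Vs : ℝ} (hE : |E - n * Vs| ≤ 3 / 2)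
    (hV1 : 9 / 5 ≤ |Vs|) (hV2 : |Vs| ≤ 101 / 5) :
    |prim (n * η) E - (n * prim η Vs + E * Real.log n)| ≤ 3 / 2 * lipK η := by
  have hn0 : (0 : ℝ) < n := by exact_mod_cast hn
  have hn1 : (1 : ℝ) ≤ n := by exact_mod_cast hn
  obtain ⟨V, hV⟩ : ∃ V : ℝ, V = E / n := ⟨_, rfl⟩
  have hEV : E = n * V := by rw [hV]; field_simp
  rw [hEV, prim_scale hn0 hη V, show (n : ℝ) * prim η V + n * V * Real.log n - (n * prim η Vs + n * V * Real.log n) =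
    n * (prim η V - prim η Vs) by ring, abs_mul, abs_of_pos hn0]
  have hdist : (n : ℝ) * |V - Vs| ≤ 3 / 2 := by
    have : |E - n * Vs| = n * |V - Vs| := by rw [hEV, ← mul_sub, abs_mul, abs_of_pos hn0]
    rw [← this]; exact hE
  have hdist' : |V - Vs| ≤ 3 / 2 := by nlinarith [abs_nonneg (V - Vs)]
  have hseg : ∀ W ∈ Set.uIcc Vs V, 3 / 10 ≤ |W| ∧ |W| ≤ 22 := by
    intro W hW
    have hWd : |W - Vs| ≤ |V - Vs| := Set.abs_sub_left_of_mem_uIcc hW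
    have h1 : |Vs| - |W - Vs| ≤ |W| := by
      have := abs_sub_abs_le_abs_sub Vs W
      rw [abs_sub_comm] at this
      linarith
    have h2 : |W| ≤ |Vs| + |W - Vs| := by
      have := abs_add_le Vs (W - Vs)
      simpa using this
    constructor <;> linarith
  have hL := abs_prim_sub_prim_le hη (m := 3 / 10) (M := 22) (by norm_num) (by norm_num) hseg
  have hK := lipK_nonneg η
  calc (n : ℝ) * |prim η V - prim η Vs| ≤ n * ((|Real.log (3 / 10)| + Real.log (22 ^ 2 + η ^ 2) / 2) * |V - Vs|) :=
        mul_le_mul_of_nonneg_left hL hn0.le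
    _ = lipK η * (n * |V - Vs|) := by unfold lipK; ring
    _ ≤ lipK η * (3 / 2) := mul_le_mul_of_nonneg_left hdist hK
    _ = 3 / 2 * lipK η := by ring

/-- An endpoint halfLog term: `halfLog (nη) E ≤ log n + ½log(22²+η²)` when `|E| ≤ 22n`. -/
theorem halfLog_endpoint (hη : η ≠ 0) {n : ℕ} (hn : 1 ≤ n) {E : ℝ} (hE : |E| ≤ 22 * n) :
    halfLog (n * η) E ≤ Real.log n + Real.log (22 ^ 2 + η ^ 2) / 2 := by
  have hn0 : (0 : ℝ) < n := by exact_mod_cast hn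
  obtain ⟨V, hV⟩ : ∃ V : ℝ, V = E / n := ⟨_, rfl⟩
  have hEV : E = n * V := by rw [hV]; field_simp
  rw [hEV, halfLog_scale hn0 hη V]
  have hVb : |V| ≤ 22 := by
    rw [hV, abs_div, abs_of_pos hn0, div_le_iff₀ hn0]; exact hE
  have hV2 : V ^ 2 ≤ 22 ^ 2 := by nlinarith [abs_nonneg V, sq_abs V, abs_le.1 hVb]
  have h2 : Real.log (V ^ 2 + η ^ 2) ≤ Real.log (22 ^ 2 + η ^ 2) :=
    Real.log_le_log (by positivity) (by nlinarith)
  have h3 : halfLog η V ≤ Real.log (22 ^ 2 + η ^ 2) / 2 := by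
    unfold halfLog; exact div_le_div_of_nonneg_right h2 (by norm_num)
  exact add_le_add_right h3 (Real.log n)

set_option maxHeartbeats 400000 in
/-- **The scaled line bound** (E5 minus the certificate and the `dy`-assembly): for `n ≥ 1`, `η ≠ 0`,
`log ‖R_n(uₙ + i·nη)‖ ≤ n·rateG η + 2 log n + 9 log(22² + η²) + (12|log(3/10)| + 3(1 + log 2) + 1)`. -/
theorem log_norm_ratRC_line_le (hη : η ≠ 0) {n : ℕ} (hn : 1 ≤ n) :
    Real.log ‖ratRC n ((uLine n : ℂ) + (((n : ℝ) * η : ℝ) : ℂ) * I)‖ ≤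
      n * rateG η + 2 * Real.log n + 9 * Real.log (22 ^ 2 + η ^ 2)
        + (12 * |Real.log (3 / 10)| + 3 * (1 + Real.log 2) + 1) := by
  have hn0 : (0 : ℝ) < n := by exact_mod_cast hn
  have hn1 : (1 : ℝ) ≤ n := by exact_mod_cast hn
  have hy : (n : ℝ) * η ≠ 0 := mul_ne_zero hn0.ne' hη
  obtain ⟨hu1, hu2⟩ := uLine_bounds n
  set u : ℝ := uLine n with hu
  have hB := log_norm_ratRC_le hy hn (u := u) (by linarith : 0 ≤ u + 15 * n)
  -- the eight endpoints
  have a1 : (9:ℝ) / 5 ≤ |(36:ℝ) / 5| ∧ |(36:ℝ) / 5| ≤ 101 / 5 := by rw [abs_of_pos (by norm_num)]; norm_num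
  have a2 : (9:ℝ) / 5 ≤ |(-29:ℝ) / 5| ∧ |(-29:ℝ) / 5| ≤ 101 / 5 := by rw [abs_of_neg (by norm_num)]; norm_num
  have a3 : (9:ℝ) / 5 ≤ |(26:ℝ) / 5| ∧ |(26:ℝ) / 5| ≤ 101 / 5 := by rw [abs_of_pos (by norm_num)]; norm_num
  have a4 : (9:ℝ) / 5 ≤ |(-19:ℝ) / 5| ∧ |(-19:ℝ) / 5| ≤ 101 / 5 := by rw [abs_of_neg (by norm_num)]; norm_num
  have a5 : (9:ℝ) / 5 ≤ |(16:ℝ) / 5| ∧ |(16:ℝ) / 5| ≤ 101 / 5 := by rw [abs_of_pos (by norm_num)]; norm_num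
  have a6 : (9:ℝ) / 5 ≤ |(-9:ℝ) / 5| ∧ |(-9:ℝ) / 5| ≤ 101 / 5 := by rw [abs_of_neg (by norm_num)]; norm_num
  have a7 : (9:ℝ) / 5 ≤ |(101:ℝ) / 5| ∧ |(101:ℝ) / 5| ≤ 101 / 5 := by rw [abs_of_pos (by norm_num)]; norm_num
  have a8 : (9:ℝ) / 5 ≤ |(46:ℝ) / 5| ∧ |(46:ℝ) / 5| ≤ 101 / 5 := by rw [abs_of_pos (by norm_num)]; norm_num
  obtain ⟨e1a, e1b⟩ := abs_le.1 (prim_endpoint hη hn (E := u + 13 * n) (Vs := 36 / 5)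
    (by rw [abs_le]; constructor <;> linarith) a1.1 a1.2)
  obtain ⟨e2a, e2b⟩ := abs_le.1 (prim_endpoint hη hn (E := u + 1) (Vs := -29 / 5)
    (by rw [abs_le]; constructor <;> linarith) a2.1 a2.2)
  obtain ⟨e3a, e3b⟩ := abs_le.1 (prim_endpoint hη hn (E := u + 11 * n) (Vs := 26 / 5)
    (by rw [abs_le]; constructor <;> linarith) a3.1 a3.2)
  obtain ⟨e4a, e4b⟩ := abs_le.1 (prim_endpoint hη hn (E := u + (2 * n + 1)) (Vs := -19 / 5)
    (by rw [abs_le]; constructor <;> linarith) a4.1 a4.2)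
  obtain ⟨e5a, e5b⟩ := abs_le.1 (prim_endpoint hη hn (E := u + 9 * n) (Vs := 16 / 5)
    (by rw [abs_le]; constructor <;> linarith) a5.1 a5.2)
  obtain ⟨e6a, e6b⟩ := abs_le.1 (prim_endpoint hη hn (E := u + (4 * n + 1)) (Vs := -9 / 5)
    (by rw [abs_le]; constructor <;> linarith) a6.1 a6.2)
  obtain ⟨e7a, e7b⟩ := abs_le.1 (prim_endpoint hη hn (E := u + (26 * n + 1)) (Vs := 101 / 5)
    (by rw [abs_le]; constructor <;> linarith) a7.1 a7.2)
  obtain ⟨e8a, e8b⟩ := abs_le.1 (prim_endpoint hη hn (E := u + 15 * n) (Vs := 46 / 5)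
    (by rw [abs_le]; constructor <;> linarith) a8.1 a8.2)
  -- the six endpoint halfLog terms
  have l1 := halfLog_endpoint hη hn (E := u + 1) (by rw [abs_le]; constructor <;> linarith)
  have l2 := halfLog_endpoint hη hn (E := u + 13 * n) (by rw [abs_le]; constructor <;> linarith)
  have l3 := halfLog_endpoint hη hn (E := u + (2 * n + 1)) (by rw [abs_le]; constructor <;> linarith)
  have l4 := halfLog_endpoint hη hn (E := u + 11 * n) (by rw [abs_le]; constructor <;> linarith)
  have l5 := halfLog_endpoint hη hn (E := u + (4 * n + 1)) (by rw [abs_le]; constructor <;> linarith)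
  have l6 := halfLog_endpoint hη hn (E := u + 9 * n) (by rw [abs_le]; constructor <;> linarith)
  -- Stirling
  have c11 : Real.log ((11 * n : ℕ) : ℝ) = Real.log 11 + Real.log n := by
    push_cast; exact Real.log_mul (by norm_num) hn0.ne'
  have c13 : Real.log ((13 * n : ℕ) : ℝ) = Real.log 13 + Real.log n := by
    push_cast; exact Real.log_mul (by norm_num) hn0.ne'
  have c9 : Real.log ((9 * n : ℕ) : ℝ) = Real.log 9 + Real.log n := by
    push_cast; exact Real.log_mul (by norm_num) hn0.ne'
  have c5 : Real.log ((5 * n : ℕ) : ℝ) = Real.log 5 + Real.log n := by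
    push_cast; exact Real.log_mul (by norm_num) hn0.ne'
  have s11 := (log_factorial_two_sided (n := 11 * n) (by omega)).2
  have s13 := (log_factorial_two_sided (n := 13 * n) (by omega)).1
  have s9 := (log_factorial_two_sided (n := 9 * n) (by omega)).1
  have s5 := (log_factorial_two_sided (n := 5 * n) (by omega)).1
  rw [c11] at s11; rw [c13] at s13; rw [c9] at s9; rw [c5] at s5
  simp only [Nat.cast_mul, Nat.cast_ofNat] at s11 s13 s9 s5
  have hlogn : 0 ≤ Real.log n := Real.log_nonneg hn1
  have hlog11 : Real.log 11 ≤ Real.log 13 := Real.log_le_log (by norm_num) (by norm_num)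
  have hlog9 : 0 ≤ Real.log 9 := Real.log_nonneg (by norm_num)
  have hlog5 : 0 ≤ Real.log 5 := Real.log_nonneg (by norm_num)
  -- linearise the products (each product is an atom for `linarith`)
  have p1 : (u + 13 * n) * Real.log n = u * Real.log n + 13 * (n * Real.log n) := by ring
  have p2 : (u + 1) * Real.log n = u * Real.log n + Real.log n := by ring
  have p3 : (u + 11 * n) * Real.log n = u * Real.log n + 11 * (n * Real.log n) := by ring
  have p4 : (u + (2 * n + 1)) * Real.log n = u * Real.log n + 2 * (n * Real.log n) + Real.log n := by ring
  have p5 : (u + 9 * n) * Real.log n = u * Real.log n + 9 * (n * Real.log n) := by ring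
  have p6 : (u + (4 * n + 1)) * Real.log n = u * Real.log n + 4 * (n * Real.log n) + Real.log n := by ring
  have p7 : (u + (26 * n + 1)) * Real.log n = u * Real.log n + 26 * (n * Real.log n) + Real.log n := by ring
  have p8 : (u + 15 * n) * Real.log n = u * Real.log n + 15 * (n * Real.log n) := by ring
  have q11 : (11 * (n : ℝ)) * (Real.log 11 + Real.log n) = 11 * (n * Real.log 11) + 11 * (n * Real.log n) := by ring
  have q13 : (13 * (n : ℝ)) * (Real.log 13 + Real.log n) = 13 * (n * Real.log 13) + 13 * (n * Real.log n) := by ring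
  have q9 : (9 * (n : ℝ)) * (Real.log 9 + Real.log n) = 9 * (n * Real.log 9) + 9 * (n * Real.log n) := by ring
  have q5 : (5 * (n : ℝ)) * (Real.log 5 + Real.log n) = 5 * (n * Real.log 5) + 5 * (n * Real.log n) := by ring
  have hG : (n : ℝ) * rateG η = n * prim η (36 / 5) - n * prim η (-29 / 5) + (n * prim η (26 / 5) - n * prim η (-19 / 5))
      + (n * prim η (16 / 5) - n * prim η (-9 / 5)) - (n * prim η (101 / 5) - n * prim η (46 / 5)) + 16 * n
      + (11 * (n * Real.log 11) - 13 * (n * Real.log 13) - 9 * (n * Real.log 9) - 5 * (n * Real.log 5)) := by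
    unfold rateG kappaP15; ring
  have hK := lipK_nonneg η
  have hKdef : lipK η = |Real.log (3 / 10)| + Real.log (22 ^ 2 + η ^ 2) / 2 := rfl
  rw [hG]
  linarith [e1a, e1b, e2a, e2b, e3a, e3b, e4a, e4b, e5a, e5b, e6a, e6b, e7a, e7b, e8a, e8b, l1, l2, l3, l4, l5, l6,
    s11, s13, s9, s5, p1, p2, p3, p4, p5, p6, p7, p8, q11, q13, q9, q5, hB, hK, hKdef, hlogn, hlog11, hlog9, hlog5]

end Summit.KontsevichZagierPeriods.Zeta5Search.TwoTaleLineBound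

end
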